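import Summits.AnomalousDissipation.AnomalousDissipation.Theorems.SawtoothPulseCascadeK1LocalisedCascadeAxisKernel

/-!
# K1loc, line `Spectral` / thin start — helper: CORNER LAYERS ON THE CIRCLE (continuous majorants, phase distance, measure)

Helper file of the prover lane on the crux `K1LocalisedCascade` (stmt-AnomalousDissipation-19491), route
`SawtoothPulseCascade` (S-D fibre ledger, plumbing for the half-step instantiation).  The pointwise bounds of `…SawtoothChirp`
hold for points whose phase `2πN t` is `r`-far from the corners `π/2 + πm`; the window lemma wants a CONTINUOUS majorant `ρ` on the
circle with controlled `∫ρ²`.  With the finite corner set `C_N = {((2m+1)/(4N) : T) : 0 ≤ m < 2N}` and the tent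
`φ_w(b) = max(0, 1 − infDist(b, C_N)/w)`:
* `corner_mem` — every corner `(2m+1)/(4N)`, `m ∈ ℤ`, reduces into `C_N`;
* `phase_far_of_le_infDist` — if `w ≤ infDist(t, C_N)` then `2πNw ≤ |2πNt − (π/2 + πm)|` for every `m ∈ ℤ`;
* `continuous_tent`, `tent_nonneg`, `tent_le_one`, `half_le_tent_of_infDist_lt` (`φ_{2w} ≥ ½` on the `w`-layer);
* `volume_layer_le` — `vol{b : infDist(b, C_N) < w} ≤ 2N · 2w`;
* `integral_majorant_sq_le` — for `ρ = ε + A·φ_{w}` (`ε, A ≥ 0`): `∫_T ρ² ≤ ε² + (ε + A)²·(2N·2w)`.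
No definitions (the corner set and the tent are written out); no statement about the crux. [folklore] [problem: turb]
-/

-- `Summit.<Summit>.<Problem>`: single-conjunct summit, the duplicate namespace segment is deliberate.
set_option linter.dupNamespace false

noncomputable section

namespace Summit.AnomalousDissipation.AnomalousDissipation.Theorems.SawtoothPulseCascade.K1Window

open MeasureTheory Set Filter Topology Function Metric
open scoped Real ENNReal NNReal

/-! ## §1 Norms of lifts, the corner set, the phase distance -/

/-- Every corner `(2m+1)/(4N)` (`m ∈ ℤ`) coincides on the circle with a corner of index in `[0, 2N)`. [folklore] -/
theorem corner_mem {N : ℕ} (hN : 0 < N) (m : ℤ) :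
    (((2 * (m : ℝ) + 1) / (4 * N) : ℝ) : UnitAddCircle) ∈
      ((Finset.Ico (0 : ℤ) (2 * N)).image fun l : ℤ => (((2 * (l : ℝ) + 1) / (4 * N) : ℝ) : UnitAddCircle)) := by
  have h2N : (0 : ℤ) < 2 * (N : ℤ) := by exact_mod_cast (by omega : 0 < 2 * N)
  have hNr : (0 : ℝ) < N := by exact_mod_cast hN
  set l : ℤ := m % (2 * (N : ℤ)) with hl
  set q : ℤ := m / (2 * (N : ℤ)) with hq
  have hml : m = 2 * (N : ℤ) * q + l := by rw [hl, hq]; have h := Int.emod_add_mul_ediv m (2 * (N : ℤ)); linarith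
  refine Finset.mem_image.mpr ⟨l, Finset.mem_Ico.mpr ⟨Int.emod_nonneg m h2N.ne', Int.emod_lt_of_pos m h2N⟩, ?_⟩
  rw [QuotientAddGroup.eq_iff_sub_mem, AddSubgroup.mem_zmultiples_iff]
  refine ⟨-q, ?_⟩
  have : (m : ℝ) = 2 * (N : ℝ) * q + l := by exact_mod_cast hml
  rw [this]; field_simp; ring

/-- **Far from the corner set ⇒ far in phase from every corner**: if `w ≤ infDist(t, C_N)` then
`2πNw ≤ |2πNt − (π/2 + πm)|` for all `m ∈ ℤ`. [folklore] -/
theorem phase_far_of_le_infDist {N : ℕ} (hN : 0 < N) {w t : ℝ}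
    (h : w ≤ infDist (t : UnitAddCircle)
      (((Finset.Ico (0 : ℤ) (2 * N)).image fun l : ℤ => (((2 * (l : ℝ) + 1) / (4 * N) : ℝ) : UnitAddCircle)) : Set UnitAddCircle))
    (m : ℤ) : 2 * π * N * w ≤ |2 * π * N * t - (π / 2 + π * m)| := by
  have hNr : (0 : ℝ) < N := by exact_mod_cast hN
  have hc : 0 < 2 * π * (N : ℝ) := by positivity
  have hmem := corner_mem hN m
  have h1 : infDist (t : UnitAddCircle) (((Finset.Ico (0 : ℤ) (2 * N)).image
      fun l : ℤ => (((2 * (l : ℝ) + 1) / (4 * N) : ℝ) : UnitAddCircle)) : Set UnitAddCircle) ≤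
      dist (t : UnitAddCircle) ((((2 * (m : ℝ) + 1) / (4 * N) : ℝ) : UnitAddCircle)) :=
    infDist_le_dist_of_mem (by exact_mod_cast hmem)
  -- `‖(x : T)‖ ≤ |x|` (tree: `Literature.Barriers.AtomisticToContinuum.HeatConduction.norm_coe_unitAddCircle_le_abs`, not imported)
  have hna : ∀ x : ℝ, ‖(x : UnitAddCircle)‖ ≤ |x| := by
    intro x
    by_cases hx : |x| ≤ 1 / 2
    · exact ((AddCircle.norm_coe_eq_abs_iff (1 : ℝ) one_ne_zero).mpr (by simpa using hx)).le
    · have h := AddCircle.norm_le_half_period (1 : ℝ) one_ne_zero (x := (x : UnitAddCircle))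
      push Not at hx
      rw [abs_one] at h
      linarith
  have h2 : dist (t : UnitAddCircle) ((((2 * (m : ℝ) + 1) / (4 * N) : ℝ) : UnitAddCircle)) ≤ |t - (2 * m + 1) / (4 * N)| := by
    rw [dist_eq_norm, ← AddCircle.coe_sub]; exact hna _
  have h3 : w ≤ |t - (2 * m + 1) / (4 * N)| := h.trans (h1.trans h2)
  have e : 2 * π * N * t - (π / 2 + π * m) = 2 * π * N * (t - (2 * m + 1) / (4 * N)) := by field_simp; ring
  rw [e, abs_mul, abs_of_pos hc]
  exact mul_le_mul_of_nonneg_left h3 hc.le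

/-! ## §2 The tent majorant -/

/-- The tent `b ↦ max(0, 1 − infDist(b, C)/w)` is continuous. [folklore] -/
theorem continuous_tent (C : Set UnitAddCircle) (w : ℝ) :
    Continuous fun b : UnitAddCircle => max 0 (1 - infDist b C / w) :=
  continuous_const.max (continuous_const.sub ((continuous_infDist_pt C).div_const w))

/-- `0 ≤ tent ≤ 1` (for `w > 0`). [folklore] -/
theorem tent_nonneg_le_one (C : Set UnitAddCircle) {w : ℝ} (hw : 0 < w) (b : UnitAddCircle) :
    0 ≤ max 0 (1 - infDist b C / w) ∧ max 0 (1 - infDist b C / w) ≤ 1 :=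
  ⟨le_max_left _ _, max_le zero_le_one (by linarith [div_nonneg (infDist_nonneg (x := b) (s := C)) hw.le])⟩

/-- On the `w`-layer the tent of width `2w` is at least `½`. [folklore] -/
theorem half_le_tent_of_infDist_lt (C : Set UnitAddCircle) {w : ℝ} (hw : 0 < w) {b : UnitAddCircle} (hb : infDist b C < w) :
    1 / 2 ≤ max 0 (1 - infDist b C / (2 * w)) := by
  refine le_max_of_le_right ?_
  have : infDist b C / (2 * w) ≤ 1 / 2 := by rw [div_le_iff₀ (by positivity)]; linarith
  linarith

/-- Off the `w`-layer the tent of width `w` vanishes. [folklore] -/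
theorem tent_eq_zero_of_le_infDist (C : Set UnitAddCircle) {w : ℝ} (hw : 0 < w) {b : UnitAddCircle} (hb : w ≤ infDist b C) :
    max 0 (1 - infDist b C / w) = 0 :=
  max_eq_left (by rw [sub_nonpos, le_div_iff₀ hw, one_mul]; exact hb)

/-! ## §3 Measure of the layer and the `L²` mass of the majorant -/

/-- **Measure of the `w`-layer around `C_N`**: `vol{b : infDist(b, C_N) < w} ≤ 2N·2w`. [folklore] -/
theorem volume_layer_le {N : ℕ} (hN : 0 < N) (w : ℝ) :
    volume {b : UnitAddCircle | infDist b (((Finset.Ico (0 : ℤ) (2 * N)).image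
      fun l : ℤ => (((2 * (l : ℝ) + 1) / (4 * N) : ℝ) : UnitAddCircle)) : Set UnitAddCircle) < w} ≤
      ENNReal.ofReal (2 * N * (2 * w)) := by
  classical
  set S : Finset UnitAddCircle := (Finset.Ico (0 : ℤ) (2 * N)).image
    fun l : ℤ => (((2 * (l : ℝ) + 1) / (4 * N) : ℝ) : UnitAddCircle) with hS
  have h0mem : (0 : ℤ) ∈ Finset.Ico (0 : ℤ) (2 * N) := Finset.mem_Ico.mpr ⟨le_rfl, by exact_mod_cast (by omega : 0 < 2 * N)⟩
  have hne : (S : Set UnitAddCircle).Nonempty := Finset.coe_nonempty.mpr (Finset.Nonempty.image ⟨0, h0mem⟩ _)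
  have hsub : {b : UnitAddCircle | infDist b (S : Set UnitAddCircle) < w} ⊆ ⋃ c ∈ S, ball c w := by
    intro b hb
    obtain ⟨c, hc, hbc⟩ := (infDist_lt_iff hne).mp hb
    exact mem_iUnion₂.mpr ⟨c, by exact_mod_cast hc, mem_ball.mpr hbc⟩
  refine (measure_mono hsub).trans ((measure_biUnion_finset_le S _).trans ?_)
  have hball : ∀ c ∈ S, volume (ball c w) ≤ ENNReal.ofReal (2 * w) := by
    intro c _
    refine (measure_mono ball_subset_closedBall).trans ?_
    rw [AddCircle.volume_closedBall]
    exact ENNReal.ofReal_le_ofReal (min_le_right _ _)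
  refine (Finset.sum_le_sum hball).trans ?_
  rw [Finset.sum_const, nsmul_eq_mul]
  have hcard : (S.card : ℝ≥0∞) ≤ (2 * N : ℕ) := by
    have h1 : S.card ≤ (Finset.Ico (0 : ℤ) (2 * N)).card := Finset.card_image_le
    rw [Int.card_Ico] at h1
    have h2 : S.card ≤ 2 * N := by omega
    exact_mod_cast h2
  have hN2 : ENNReal.ofReal (2 * N * (2 * w)) = ((2 * N : ℕ) : ℝ≥0∞) * ENNReal.ofReal (2 * w) := by
    rw [ENNReal.ofReal_mul (by positivity), show (2 * (N : ℝ)) = ((2 * N : ℕ) : ℝ) by push_cast; ring,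
      ENNReal.ofReal_natCast]
  rw [hN2]
  exact mul_le_mul' hcard le_rfl

/-- **`L²` mass of the majorant `ρ = ε + A·φ_w`** (`ε, A ≥ 0`, `w > 0`): `∫_T ρ² ≤ ε² + (ε + A)²·(2N·2w)`.  Off the `w`-layer
`ρ = ε`; on it `ρ ≤ ε + A`. [folklore] -/
theorem integral_majorant_sq_le {N : ℕ} (hN : 0 < N) {w ε A : ℝ} (hw : 0 < w) (hε : 0 ≤ ε) (hA : 0 ≤ A) :
    ∫ b : UnitAddCircle, (ε + A * max 0 (1 - infDist b (((Finset.Ico (0 : ℤ) (2 * N)).image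
      fun l : ℤ => (((2 * (l : ℝ) + 1) / (4 * N) : ℝ) : UnitAddCircle)) : Set UnitAddCircle) / w)) ^ 2 ≤
      ε ^ 2 + (ε + A) ^ 2 * (2 * N * (2 * w)) := by
  classical
  set C : Set UnitAddCircle := (((Finset.Ico (0 : ℤ) (2 * N)).image
      fun l : ℤ => (((2 * (l : ℝ) + 1) / (4 * N) : ℝ) : UnitAddCircle)) : Set UnitAddCircle) with hC
  set L : Set UnitAddCircle := {b | infDist b C < w} with hL
  have hLo : IsOpen L := isOpen_lt (continuous_infDist_pt C) continuous_const
  have hLm : MeasurableSet L := hLo.measurableSet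
  -- pointwise: `ρ² ≤ ε² + (ε+A)²·1_L`
  have hpt : ∀ b : UnitAddCircle, (ε + A * max 0 (1 - infDist b C / w)) ^ 2 ≤ ε ^ 2 + (ε + A) ^ 2 * L.indicator 1 b := by
    intro b
    by_cases hb : infDist b C < w
    · have hmem : b ∈ L := hb
      rw [indicator_of_mem hmem, Pi.one_apply, mul_one]
      obtain ⟨h0, h1⟩ := tent_nonneg_le_one C hw b
      have : ε + A * max 0 (1 - infDist b C / w) ≤ ε + A := by nlinarith
      have h2 : (ε + A * max 0 (1 - infDist b C / w)) ^ 2 ≤ (ε + A) ^ 2 := pow_le_pow_left₀ (by positivity) this 2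
      nlinarith [sq_nonneg ε]
    · have hnot : b ∉ L := hb
      rw [indicator_of_notMem hnot, mul_zero, add_zero, tent_eq_zero_of_le_infDist C hw (not_lt.mp hb), mul_zero, add_zero]
  have hρc : Continuous fun b : UnitAddCircle => (ε + A * max 0 (1 - infDist b C / w)) ^ 2 :=
    (continuous_const.add (continuous_const.mul (continuous_tent C w))).pow 2
  have hI1 : Integrable (fun b : UnitAddCircle => (ε + A * max 0 (1 - infDist b C / w)) ^ 2) :=
    hρc.integrable_of_hasCompactSupport (HasCompactSupport.of_compactSpace _)
  have hIc : Integrable (fun _ : UnitAddCircle => ε ^ 2) := integrable_const _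
  have hIi : Integrable (fun b : UnitAddCircle => (ε + A) ^ 2 * L.indicator 1 b) :=
    ((integrable_const (1 : ℝ)).indicator hLm).const_mul ((ε + A) ^ 2)
  have hI2 : Integrable (fun b : UnitAddCircle => ε ^ 2 + (ε + A) ^ 2 * L.indicator 1 b) := hIc.add hIi
  refine (integral_mono hI1 hI2 hpt).trans ?_
  rw [integral_add hIc hIi, integral_const, integral_const_mul, integral_indicator hLm, probReal_univ, one_smul]
  simp only [Pi.one_apply, setIntegral_const, smul_eq_mul, mul_one]
  have hvol : (volume L).toReal ≤ 2 * N * (2 * w) := by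
    have h := volume_layer_le hN w
    rw [← hC, ← hL] at h
    exact ENNReal.toReal_le_of_le_ofReal (by positivity) h
  rw [Measure.real]
  nlinarith [sq_nonneg (ε + A)]

end Summit.AnomalousDissipation.AnomalousDissipation.Theorems.SawtoothPulseCascade.K1Window
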